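import Literature.NumberTheory.EllipticCurves.CuspFormRankinSelbergCoefficients
import Literature.NumberTheory.EllipticCurves.ModularDegreeFormulaDomainProofs
import Literature.NumberTheory.EllipticCurves.CuspFormLFunctionNewformFrickeProofs
import HarnessLib

/-!
# The Rankin–Selberg trace of a newform: Petersson norm and the Fricke cosets

Topic `NumberTheory/EllipticCurves` (modular forms on `Γ₀(N)`); namespace
`Literature.NumberTheory.EllipticCurves.ModularForms`. Proof file (theorems only; no definition,
no named fact), a complement to `CuspFormRankinSelbergTrace` / `CuspFormRankinSelbergCoefficients`
(the `SL₂(ℤ)`-trace `G_f = rsTrace N k f = Σ_{SL₂(ℤ)/Γ₀(N)} |f ∣ A⁻¹|² yᵏ` and its coefficient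
sequence `rsCoeff N k f n = Σ_A |cₙ(f ∣ A⁻¹)|²`, Rankin 1939, §4). Two inputs of the Siegel-type
lower bound for the Petersson norm of a newform in the level aspect
(`NewformPeterssonSizeSiegelProofs`):

* `sum_petersson_out_eq_rsTrace`, `peterssonProduct_self_eq_integral_rsTrace`,
  `peterssonProduct_self_re_eq_integral_rsTrace` — **`(f, f)_{Γ₀(N)} = ∫_𝒟 G_f dμ`** for the tree's
  `peterssonProduct` (`HeckeOperators`; the two coset spaces `𝒮ℒ/Γ₀(N)` inside `GL₂(ℝ)` and
  `SL₂(ℤ)/Γ₀(N)` are matched through `exists_mapGL_eq_out`, `coset_eq_iff` of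
  `ModularDegreeFormulaDomainProofs`);
* `IsNewform0.exists_apply_frickeGL_smul`, `IsNewform0.exists_slash_S_apply` — for a NEWFORM
  `f ∈ S₂(Γ₀(N))` with Fricke eigenvalue `ε = ±1` (Atkin–Lehner 1970, Thm. 3; in the tree
  `IsNewform0.exists_frickeInvolution_eq_smul_holds`, `frickeInvolution_apply_eq_slash_holds`):
  **`(f ∣[2] S)(τ) = (ε/N) f(τ/N)`**;
* `IsNewform0.exists_qExpansion_coeff_slash_S` — hence the period-`N` coefficients
  `cₙ(f ∣ S) = (ε/N) aₙ(f)`; `norm_qExpansion_coeff_slash_mul_T_zpow` — `|cₙ(f ∣ A T^j)| = |cₙ(f ∣ A)|`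
  (Fourier coefficients along a horocycle, `IsCuspFunction.fourierCoeffOn_horizontal`, with the
  substitutions `x = Nu` and `x ↦ x + j`);
* `S_mul_T_zpow_mul_S_inv_mem_Gamma0_iff` — `S T^m S⁻¹ = (1 0; -m 1) ∈ Γ₀(N) ⟺ N ∣ m`, so the `N`
  cosets `(S T^j)⁻¹Γ₀(N)`, `0 ≤ j < N` (the cusp `0`, of width `N`) are distinct, whence
  **`IsNewform0.inv_le_rsCoeff_one`: `rsCoeff N 2 f 1 ≥ N · |ε a₁(f)/N|² = 1/N`**.

(The identity coset contributes to `rsCoeff N 2 f n` only for `N ∣ n` (`norm_sq_cuspCoeff_le_rsCoeff`);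
it is the cusp `0` that makes the first coefficient of the trace Dirichlet series of size `1/N`.)

## References

* A. O. L. Atkin, J. Lehner, *Hecke operators on `Γ₀(m)`*, Math. Ann. 185 (1970), 134–160, Thm. 3.
  [cite: AtkinLehner1970, Thm. 3]
* R. A. Rankin, Proc. Cambridge Philos. Soc. 35 (1939), 357–372, §4. [cite: Rankin1939, §4]
-/

noncomputable section

open ModularForm CongruenceSubgroup Complex Filter MeasureTheory Set
open UpperHalfPlane hiding I
open scoped MatrixGroups ModularForm Topology

namespace Literature.NumberTheory.EllipticCurves.ModularForms

/-! ### The Petersson norm is the integral of the trace over `𝒟` -/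

section TraceIntegral

variable {N : ℕ} [NeZero N] {k : ℤ}

omit [NeZero N] in
/-- The coset sum in `peterssonProduct (Gamma0 N) k f f` (over `𝒮ℒ/Γ₀(N)` inside `GL₂(ℝ)`,
evaluated at `Quotient.out`) is the trace `G_f = rsTrace N k f` (over `SL₂(ℤ)/Γ₀(N)`): both are
the sum of `|f(A⁻¹τ)|²(Im A⁻¹τ)ᵏ` over a system of left-coset representatives. [folklore] -/
theorem sum_petersson_out_eq_rsTrace
    [Fintype (↥𝒮ℒ ⧸ (Gamma0 N : Subgroup (GL (Fin 2) ℝ)).subgroupOf 𝒮ℒ)]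
    [Fintype (SL(2, ℤ) ⧸ Gamma0 N)] (f : CuspForm (Gamma0 N) k) (τ : ℍ) :
    ∑ q : ↥𝒮ℒ ⧸ (Gamma0 N : Subgroup (GL (Fin 2) ℝ)).subgroupOf 𝒮ℒ,
        petersson k ⇑f ⇑f (((q.out : ↥𝒮ℒ) : GL (Fin 2) ℝ)⁻¹ • τ) = (rsTrace N k f τ : ℂ) := by
  obtain ⟨g, hg⟩ := exists_mapGL_eq_out (N := N)
  -- evaluate the Petersson integrand at the representatives `g q ∈ SL(2, ℤ)`
  have hpt : ∀ q, petersson k ⇑f ⇑f (((q.out : ↥𝒮ℒ) : GL (Fin 2) ℝ)⁻¹ • τ) =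
      (petDensity k f ((g q)⁻¹ • τ) : ℂ) := by
    intro q
    have hsm : ((q.out : ↥𝒮ℒ) : GL (Fin 2) ℝ)⁻¹ • τ = (g q)⁻¹ • τ := by
      rw [← hg q, ← map_inv]; rfl
    rw [hsm, ofReal_petDensity]
  simp_rw [hpt]
  rw [rsTrace_eq_sum]
  push_cast
  -- the bijection `q ↦ (g q) Γ₀(N)` between the two coset spaces
  set e : (↥𝒮ℒ ⧸ (Gamma0 N : Subgroup (GL (Fin 2) ℝ)).subgroupOf 𝒮ℒ) → SL(2, ℤ) ⧸ Gamma0 N :=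
    fun q ↦ QuotientGroup.mk (g q) with he
  have hbij : Function.Bijective e := by
    constructor
    · intro q r hqr
      rw [coset_eq_iff g hg]
      exact QuotientGroup.eq.mp hqr
    · intro q'
      induction q' using QuotientGroup.induction_on with
      | H s =>
        refine ⟨QuotientGroup.mk (⟨Matrix.SpecialLinearGroup.mapGL ℝ s, s, rfl⟩ : ↥𝒮ℒ), ?_⟩
        exact QuotientGroup.eq.mpr (inv_mul_mem_Gamma0_of_mk g hg s)
  refine Fintype.sum_bijective e hbij _ _ fun q ↦ ?_
  rw [he]
  dsimp only
  rw [petDensity_out_inv_smul]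

/-- **`(f, f)_{Γ₀(N)} = ∫_𝒟 G_f dμ`** as a complex number (the tree's `peterssonProduct`, no volume
normalisation, versus the trace `rsTrace N k f`). [folklore] -/
theorem peterssonProduct_self_eq_integral_rsTrace (f : CuspForm (Gamma0 N) k) :
    peterssonProduct (Gamma0 N) k f f = ((∫ τ in ModularGroup.fd, rsTrace N k f τ : ℝ) : ℂ) := by
  classical
  haveI : Fintype (SL(2, ℤ) ⧸ Gamma0 N) := Fintype.ofFinite _
  letI : Fintype (↥𝒮ℒ ⧸ (Gamma0 N : Subgroup (GL (Fin 2) ℝ)).subgroupOf 𝒮ℒ) := Fintype.ofFinite _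
  rw [peterssonProduct_eq_setIntegral, ← integral_complex_ofReal]
  refine setIntegral_congr_fun ModularGroup.isClosed_fd.measurableSet fun τ _ ↦ ?_
  exact sum_petersson_out_eq_rsTrace f τ

/-- **`Re (f, f)_{Γ₀(N)} = ∫_𝒟 G_f dμ`** (and the imaginary part vanishes). [folklore] -/
theorem peterssonProduct_self_re_eq_integral_rsTrace (f : CuspForm (Gamma0 N) k) :
    (peterssonProduct (Gamma0 N) k f f).re = ∫ τ in ModularGroup.fd, rsTrace N k f τ := by
  rw [peterssonProduct_self_eq_integral_rsTrace, Complex.ofReal_re]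

end TraceIntegral

/-! ### The Fricke cosets: `f ∣ S = (ε/N) f(·/N)` for a newform of weight `2` -/

section Fricke

variable {N : ℕ} [NeZero N]

/-- `Im (τ/N) > 0`. [folklore] -/
theorem im_div_natCast_pos (τ : ℍ) : 0 < ((τ : ℂ) / N).im := by
  rw [Complex.div_natCast_im]
  exact div_pos τ.im_pos (Nat.cast_pos.mpr (NeZero.pos N))

/-- **`f ∣[2] w_N = ε f` pointwise** for a newform `f ∈ S₂(Γ₀(N))`, `ε = ±1` its Fricke eigenvalue
(Atkin–Lehner 1970, Thm. 3, in the tree `IsNewform0.exists_frickeInvolution_eq_smul_holds` with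
`frickeInvolution_apply_eq_slash_holds`; in weight `2` the normalising scalar `N^{1-k/2}` is `1`):
`f(-1/(Nτ)) · N · (Nτ)^{-2} = ε f(τ)`. [cite: AtkinLehner1970, Thm. 3] -/
theorem IsNewform0.exists_apply_frickeGL_smul {f : CuspForm (Gamma0 N) 2} (hf : IsNewform0 f) :
    ∃ ε : ℂ, (ε = 1 ∨ ε = -1) ∧ ∀ τ : ℍ,
      f (glCast (frickeGL N : GL (Fin 2) ℚ) • τ) * N * ((N : ℂ) * τ) ^ (-2 : ℤ) = ε * f τ := by
  obtain ⟨ε, hε, hW⟩ := IsNewform0.exists_frickeInvolution_eq_smul_holds hf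
  refine ⟨ε, hε, fun τ ↦ ?_⟩
  have h := frickeInvolution_apply_eq_slash_holds N 2 f
  rw [hW] at h
  have hN : ((N : ℝ) ^ (1 - ((2 : ℤ) : ℝ) / 2) : ℝ) = 1 := by norm_num
  rw [hN, Complex.ofReal_one, one_smul] at h
  have hτ : (⇑f ∣[(2 : ℤ)] glCast (frickeGL N : GL (Fin 2) ℚ)) τ = ε * f τ := by
    have := congr_fun h τ
    simpa using this.symm
  rw [← hτ, ModularForm.slash_apply, σ_glCast, det_glCast_frickeGL, denom, val_glCast_frickeGL]
  simp only [Matrix.of_apply, Matrix.cons_val', Matrix.cons_val_zero, Matrix.cons_val_one,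
    Matrix.cons_val_fin_one, Nat.abs_cast]
  push_cast
  rw [zpow_one, add_zero]

/-- **The Fricke identity on the `S`-coset**: for a newform `f ∈ S₂(Γ₀(N))` with Fricke
eigenvalue `ε`, `(f ∣[2] S)(τ) = τ^{-2} f(-1/τ) = (ε/N) f(τ/N)` (apply `f ∣ w_N = ε f` at `τ/N`,
where `w_N · (τ/N) = -1/τ`). [cite: AtkinLehner1970, Thm. 3] -/
theorem IsNewform0.exists_slash_S_apply {f : CuspForm (Gamma0 N) 2} (hf : IsNewform0 f) :
    ∃ ε : ℂ, (ε = 1 ∨ ε = -1) ∧ ∀ τ : ℍ,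
      (⇑f ∣[(2 : ℤ)] ModularGroup.S) τ = ε / N * f (UpperHalfPlane.mk ((τ : ℂ) / N) (im_div_natCast_pos τ)) := by
  obtain ⟨ε, hε, hW⟩ := hf.exists_apply_frickeGL_smul
  refine ⟨ε, hε, fun τ ↦ ?_⟩
  have hN : (N : ℂ) ≠ 0 := by exact_mod_cast NeZero.ne N
  have hτ0 : (τ : ℂ) ≠ 0 := τ.ne_zero
  set τ' : ℍ := UpperHalfPlane.mk ((τ : ℂ) / N) (im_div_natCast_pos τ) with hτ'
  have hcoe : ((τ' : ℍ) : ℂ) = (τ : ℂ) / N := rfl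
  -- `w_N • (τ/N) = -1/τ`
  have hpt : glCast (frickeGL N : GL (Fin 2) ℚ) • τ' = UpperHalfPlane.mk (-(τ : ℂ))⁻¹ τ.im_inv_neg_coe_pos := by
    refine UpperHalfPlane.ext ?_
    rw [coe_frickeGL_smul, hcoe]
    show -((N : ℂ) * ((τ : ℂ) / N))⁻¹ = (-(τ : ℂ))⁻¹
    rw [mul_div_cancel₀ _ hN, inv_neg]
  have key := hW τ'
  rw [hpt, hcoe, mul_div_cancel₀ _ hN] at key
  rw [SlashInvariantForm.slash_S_apply]
  -- key : f(-1/τ) * N * τ^(-2) = ε f(τ')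
  have e1 : f (UpperHalfPlane.mk (-(τ : ℂ))⁻¹ τ.im_inv_neg_coe_pos) * (τ : ℂ) ^ (-(2 : ℤ)) =
      (f (UpperHalfPlane.mk (-(τ : ℂ))⁻¹ τ.im_inv_neg_coe_pos) * N * (τ : ℂ) ^ (-2 : ℤ)) / N := by
    field_simp
  rw [e1, key]
  ring

/-- `f ∣[k] (A T^j)` is the translate of `f ∣[k] A`: `(f ∣ (A T^j))(τ) = (f ∣ A)(τ + j)`. [folklore] -/
theorem slash_mul_T_zpow_apply (φ : ℍ → ℂ) (k : ℤ) (A : SL(2, ℤ)) (j : ℤ) (τ : ℍ) :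
    (φ ∣[k] (A * ModularGroup.T ^ j)) τ = (φ ∣[k] A) ((j : ℝ) +ᵥ τ) := by
  rw [SlashAction.slash_mul, ModularForm.SL_slash_apply, UpperHalfPlane.modular_T_zpow_smul,
    ModularGroup.denom_apply]
  simp [ModularGroup.coe_T_zpow]

/-! ### Period-`N` coefficients of the translates -/

open intervalIntegral in
/-- **The period-`N` coefficients of `f ∣ S`**: for a newform `f ∈ S₂(Γ₀(N))` with Fricke eigenvalue
`ε`, `cₙ(f ∣[2] S) = (ε/N) aₙ(f)` — from `(f ∣ S)(x + iN) = (ε/N) f(x/N + i)` and the substitution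
`x = Nu` in the Fourier coefficient over a period (`IsCuspFunction.fourierCoeffOn_horizontal` at the
periods `N` and `1`). [cite: AtkinLehner1970, Thm. 3] -/
theorem IsNewform0.exists_qExpansion_coeff_slash_S {f : CuspForm (Gamma0 N) 2} (hf : IsNewform0 f) :
    ∃ ε : ℂ, (ε = 1 ∨ ε = -1) ∧ ∀ n : ℕ,
      (qExpansion (N : ℝ) (⇑f ∣[(2 : ℤ)] ModularGroup.S)).coeff n = ε / N * cuspCoeff f n := by
  obtain ⟨ε, hε, hS⟩ := hf.exists_slash_S_apply
  refine ⟨ε, hε, fun n ↦ ?_⟩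
  set F : ℍ → ℂ := ⇑f ∣[(2 : ℤ)] ModularGroup.S with hFdef
  have hNF : IsCuspFunction N F := isCuspFunction_slash f ModularGroup.S
  have h1f : IsCuspFunction 1 ⇑f := isCuspFunction_one f
  have hN0 : (0 : ℝ) < N := Nat.cast_pos.mpr (NeZero.pos N)
  have hNc : (N : ℂ) ≠ 0 := by exact_mod_cast NeZero.ne N
  have eN := hNF.fourierCoeffOn_horizontal hN0 (n : ℤ)
  have e1 := h1f.fourierCoeffOn_horizontal one_pos (n : ℤ)
  rw [if_pos (Int.natCast_nonneg _), Int.toNat_natCast] at eN e1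
  -- the horizontal sections: `F(x + iN) = (ε/N) f(x/N + i)`
  have hpt : ∀ x : ℝ, F (ofComplex ((x : ℂ) + (N : ℝ) * I)) =
      ε / N * f (ofComplex ((((x / N : ℝ)) : ℂ) + (1 : ℝ) * I)) := by
    intro x
    have hz : 0 < ((x : ℂ) + (N : ℝ) * I).im := by simp [hN0]
    have hz' : 0 < ((((x / N : ℝ)) : ℂ) + (1 : ℝ) * I).im := by simp
    rw [ofComplex_apply_of_im_pos hz, hS, ofComplex_apply_of_im_pos hz']
    congr 2
    refine UpperHalfPlane.ext ?_
    show ((x : ℂ) + (N : ℝ) * I) / N = (((x / N : ℝ)) : ℂ) + (1 : ℝ) * I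
    push_cast
    field_simp
  -- the two Fourier coefficients agree up to `ε/N`
  have hF : fourierCoeffOn hNF.pos (fun x : ℝ ↦ F (ofComplex ((x : ℂ) + (N : ℝ) * I))) (n : ℤ) =
      ε / N * fourierCoeffOn h1f.pos (fun x : ℝ ↦ (⇑f) (ofComplex ((x : ℂ) + (1 : ℝ) * I))) (n : ℤ) := by
    rw [fourierCoeffOn_eq_integral, fourierCoeffOn_eq_integral]
    simp_rw [hpt]
    set g : ℝ → ℂ := fun u : ℝ ↦ fourier (-(n : ℤ)) (u : AddCircle ((1 : ℝ) - 0)) •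
      (⇑f) (ofComplex (((u : ℝ) : ℂ) + (1 : ℝ) * I)) with hg
    have hi : ∀ x : ℝ, fourier (-(n : ℤ)) (x : AddCircle ((N : ℝ) - 0)) •
        (ε / N * f (ofComplex ((((x / N : ℝ)) : ℂ) + (1 : ℝ) * I))) = ε / N * g (x / N) := by
      intro x
      simp only [hg, fourier_coe_apply, sub_zero, smul_eq_mul]
      have e : (2 * Real.pi * Complex.I * (-(n : ℤ) : ℤ) * (x : ℝ) / (N : ℝ) : ℂ) =
          2 * Real.pi * Complex.I * (-(n : ℤ) : ℤ) * ((x / N : ℝ) : ℝ) / (1 : ℝ) := by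
        push_cast
        field_simp
      rw [e]
      ring
    simp_rw [hi]
    rw [intervalIntegral.integral_const_mul,
      intervalIntegral.integral_comp_div (fun u ↦ g u) hN0.ne', zero_div, div_self hN0.ne']
    simp only [sub_zero, one_div, Complex.real_smul, Complex.ofReal_one, inv_one, one_mul]
    push_cast
    field_simp
  rw [hF, e1] at eN
  -- cancel the common factor `e^{-2πn}`
  have hexp : (Real.exp (-(2 * Real.pi * n / 1) * 1) : ℂ) ≠ 0 := by
    exact_mod_cast (Real.exp_pos _).ne'
  have hexp' : (Real.exp (-(2 * Real.pi * n / N) * N) : ℂ) = (Real.exp (-(2 * Real.pi * n / 1) * 1) : ℂ) := by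
    congr 2
    field_simp
  rw [hexp'] at eN
  have key : (qExpansion (N : ℝ) F).coeff n * (Real.exp (-(2 * Real.pi * n / 1) * 1) : ℂ) =
      (ε / N * (qExpansion 1 ⇑f).coeff n) * (Real.exp (-(2 * Real.pi * n / 1) * 1) : ℂ) := by
    rw [← eN]; ring
  rw [mul_right_cancel₀ hexp key, cuspCoeff]

open intervalIntegral in
/-- **Translating by `T^j` does not change the size of the period-`N` coefficients**:
`|cₙ(f ∣ (A T^j))| = |cₙ(f ∣ A)|` for `A ∈ SL₂(ℤ)`, `j ∈ ℤ` (`(f ∣ A T^j)(τ) = (f ∣ A)(τ + j)`, so the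
`n`-th Fourier coefficient over a period is multiplied by `e^{2πinj/N}`). [folklore] -/
theorem norm_qExpansion_coeff_slash_mul_T_zpow {k : ℤ} (f : CuspForm (Gamma0 N) k) (A : SL(2, ℤ))
    (j : ℤ) (n : ℕ) :
    ‖(qExpansion (N : ℝ) (⇑f ∣[k] (A * ModularGroup.T ^ j))).coeff n‖ =
      ‖(qExpansion (N : ℝ) (⇑f ∣[k] A)).coeff n‖ := by
  set F : ℍ → ℂ := ⇑f ∣[k] A with hFdef
  set G : ℍ → ℂ := ⇑f ∣[k] (A * ModularGroup.T ^ j) with hGdef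
  have hF : IsCuspFunction N F := isCuspFunction_slash f A
  have hG : IsCuspFunction N G := isCuspFunction_slash f _
  have hN0 : (0 : ℝ) < N := Nat.cast_pos.mpr (NeZero.pos N)
  have eF := hF.fourierCoeffOn_horizontal one_pos (n : ℤ)
  have eG := hG.fourierCoeffOn_horizontal one_pos (n : ℤ)
  rw [if_pos (Int.natCast_nonneg _), Int.toNat_natCast] at eF eG
  -- `G(x + i) = F((x + j) + i)`
  have hpt : ∀ x : ℝ, G (ofComplex ((x : ℂ) + (1 : ℝ) * I)) = F (ofComplex (((x + j : ℝ) : ℂ) + (1 : ℝ) * I)) := by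
    intro x
    have hz : 0 < ((x : ℂ) + (1 : ℝ) * I).im := by simp
    have hz' : 0 < (((x + j : ℝ) : ℂ) + (1 : ℝ) * I).im := by simp
    rw [hGdef, slash_mul_T_zpow_apply, ← hFdef, ofComplex_apply_of_im_pos hz,
      ofComplex_apply_of_im_pos hz']
    congr 1
    refine UpperHalfPlane.ext ?_
    rw [UpperHalfPlane.coe_vadd]
    show ((j : ℝ) : ℂ) + ((x : ℂ) + (1 : ℝ) * I) = ((x + j : ℝ) : ℂ) + (1 : ℝ) * I
    push_cast
    ring
  -- the integrand of the coefficient of `F` and its `N`-periodicity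
  set g : ℝ → ℂ := fun u : ℝ ↦ fourier (-(n : ℤ)) (u : AddCircle ((N : ℝ) - 0)) •
    F (ofComplex (((u : ℝ) : ℂ) + (1 : ℝ) * I)) with hg
  have hgp : Function.Periodic g N := by
    intro u
    simp only [hg]
    congr 1
    · rw [sub_zero]
      congr 1
      rw [AddCircle.coe_add, AddCircle.coe_period, add_zero]
    · have := hF.periodic ((u : ℂ) + (1 : ℝ) * I)
      simp only [Function.comp_apply] at this
      push_cast
      rw [show (u : ℂ) + N + 1 * I = (u : ℂ) + 1 * I + N by ring]
      exact this
  have hshift : fourierCoeffOn hG.pos (fun x : ℝ ↦ G (ofComplex ((x : ℂ) + (1 : ℝ) * I))) (n : ℤ) =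
      fourier (n : ℤ) ((j : ℝ) : AddCircle ((N : ℝ) - 0)) *
        fourierCoeffOn hF.pos (fun x : ℝ ↦ F (ofComplex ((x : ℂ) + (1 : ℝ) * I))) (n : ℤ) := by
    rw [fourierCoeffOn_eq_integral, fourierCoeffOn_eq_integral]
    have hgi : (∫ x in (0 : ℝ)..(N : ℝ), fourier (-(n : ℤ)) (x : AddCircle ((N : ℝ) - 0)) •
        F (ofComplex ((x : ℂ) + (1 : ℝ) * I))) = ∫ x in (0 : ℝ)..(N : ℝ), g x := rfl
    rw [hgi]
    simp_rw [hpt]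
    have hi : ∀ x : ℝ, fourier (-(n : ℤ)) (x : AddCircle ((N : ℝ) - 0)) •
        F (ofComplex (((x + j : ℝ) : ℂ) + (1 : ℝ) * I)) =
          fourier (n : ℤ) ((j : ℝ) : AddCircle ((N : ℝ) - 0)) * g (x + j) := by
      intro x
      simp only [hg, fourier_coe_apply, sub_zero, smul_eq_mul, ← mul_assoc]
      congr 1
      rw [← Complex.exp_add]
      congr 1
      push_cast
      ring
    simp_rw [hi]
    rw [intervalIntegral.integral_const_mul, intervalIntegral.integral_comp_add_right (fun u ↦ g u) (j : ℝ),
      zero_add, show (N : ℝ) + j = j + N by ring, hgp.intervalIntegral_add_eq (j : ℝ) 0, zero_add]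
    simp only [Complex.real_smul, sub_zero]
    ring
  rw [hshift, eF] at eG
  -- compare and take norms
  have hexp : (Real.exp (-(2 * Real.pi * n / N) * 1) : ℂ) ≠ 0 := by
    exact_mod_cast (Real.exp_pos _).ne'
  have key : (qExpansion (N : ℝ) G).coeff n * (Real.exp (-(2 * Real.pi * n / N) * 1) : ℂ) =
      (fourier (n : ℤ) ((j : ℝ) : AddCircle ((N : ℝ) - 0)) * (qExpansion (N : ℝ) F).coeff n) *
        (Real.exp (-(2 * Real.pi * n / N) * 1) : ℂ) := by
    rw [← eG]; ring
  rw [mul_right_cancel₀ hexp key, norm_mul]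
  have h1 : ‖fourier (n : ℤ) ((j : ℝ) : AddCircle ((N : ℝ) - 0))‖ = 1 := by
    rw [fourier_coe_apply, Complex.norm_exp]
    have : (2 * Real.pi * Complex.I * (n : ℤ) * (j : ℝ) / ((N : ℝ) - 0 : ℝ) : ℂ).re = 0 := by
      simp [Complex.div_re, Complex.mul_re, Complex.mul_im]
    rw [this, Real.exp_zero]
  rw [h1, one_mul]

/-! ### The lower bound `C_f(1) ≥ 1/N` -/

omit [NeZero N] in
/-- The matrix `S T^m S⁻¹ = (1 0; -m 1)` lies in `Γ₀(N)` only if `N ∣ m`. [folklore] -/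
theorem S_mul_T_zpow_mul_S_inv_mem_Gamma0_iff (m : ℤ) :
    ModularGroup.S * ModularGroup.T ^ m * ModularGroup.S⁻¹ ∈ Gamma0 N ↔ (N : ℤ) ∣ m := by
  rw [Gamma0_mem]
  have h10 : ((ModularGroup.S * ModularGroup.T ^ m * ModularGroup.S⁻¹ : SL(2, ℤ)) :
      Matrix (Fin 2) (Fin 2) ℤ) 1 0 = -m := by
    rw [Matrix.SpecialLinearGroup.coe_mul, Matrix.SpecialLinearGroup.coe_mul,
      Matrix.SpecialLinearGroup.coe_inv, ModularGroup.coe_S, ModularGroup.coe_T_zpow,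
      Matrix.adjugate_fin_two_of]
    simp [Matrix.mul_apply, Fin.sum_univ_two]
  rw [h10, Int.cast_neg, neg_eq_zero, ZMod.intCast_zmod_eq_zero_iff_dvd]

/-- **`C_f(1) ≥ 1/N` for a newform of weight `2`.** The `N` cosets `(S T^j)⁻¹ Γ₀(N)`,
`0 ≤ j < N` (the cusp `0`, of width `N`) are distinct, and each contributes
`|c₁(f ∣ S T^j)|² = |c₁(f ∣ S)|² = |ε a₁(f)/N|² = 1/N²` to
`rsCoeff N 2 f 1 = Σ_{SL₂(ℤ)/Γ₀(N)} |c₁(f ∣ A⁻¹)|²`. [cite: AtkinLehner1970, Thm. 3] -/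
theorem IsNewform0.inv_le_rsCoeff_one {f : CuspForm (Gamma0 N) 2} (hf : IsNewform0 f) :
    (N : ℝ)⁻¹ ≤ rsCoeff N 2 f 1 := by
  classical
  haveI : Fintype (SL(2, ℤ) ⧸ Gamma0 N) := Fintype.ofFinite _
  obtain ⟨ε, hε, hcoef⟩ := hf.exists_qExpansion_coeff_slash_S
  have hN0 : (0 : ℝ) < N := Nat.cast_pos.mpr (NeZero.pos N)
  -- the representatives and their cosets
  set a : ℕ → SL(2, ℤ) := fun j ↦ ModularGroup.S * ModularGroup.T ^ (j : ℤ) with ha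
  set q : ℕ → SL(2, ℤ) ⧸ Gamma0 N := fun j ↦ QuotientGroup.mk (a j)⁻¹ with hq
  set term : SL(2, ℤ) ⧸ Gamma0 N → ℝ := fun r ↦
    ‖(qExpansion (N : ℝ) (⇑f ∣[(2 : ℤ)] (Quotient.out r)⁻¹)).coeff 1‖ ^ 2 with hterm
  -- each Fricke coset contributes `1/N²`
  have hval : ∀ j : ℕ, term (q j) = ((N : ℝ) ^ 2)⁻¹ := by
    intro j
    obtain ⟨γ, hγ⟩ := QuotientGroup.mk_out_eq_mul (Gamma0 N) (a j)⁻¹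
    have hout : (Quotient.out (q j))⁻¹ = (γ : SL(2, ℤ))⁻¹ * a j := by
      rw [hq]
      dsimp only
      rw [hγ, mul_inv_rev, inv_inv]
    rw [hterm]
    dsimp only
    rw [hout, SlashAction.slash_mul, slash_eq_self_of_mem_Gamma0 f (inv_mem γ.2), ha]
    dsimp only
    rw [norm_qExpansion_coeff_slash_mul_T_zpow f ModularGroup.S (j : ℤ) 1, hcoef 1,
      show cuspCoeff f 1 = 1 from hf.2.2, mul_one, norm_div, Complex.norm_natCast]
    have hε1 : ‖ε‖ = 1 := by rcases hε with h | h <;> simp [h]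
    rw [hε1, one_div, inv_pow]
  -- the cosets are distinct
  have hinj : Set.InjOn q (Finset.range N : Set ℕ) := by
    intro j hj j' hj' hjj'
    simp only [Finset.coe_range, Set.mem_Iio] at hj hj'
    rw [hq] at hjj'
    dsimp only at hjj'
    have hmem := QuotientGroup.eq.mp hjj'
    rw [inv_inv, ha] at hmem
    dsimp only at hmem
    rw [mul_inv_rev, ← mul_assoc, mul_assoc ModularGroup.S, ← zpow_neg, ← zpow_add,
      ← sub_eq_add_neg, S_mul_T_zpow_mul_S_inv_mem_Gamma0_iff] at hmem
    have habs : |((j : ℤ) - j')| < N := by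
      rw [abs_lt]; constructor <;> omega
    have := Int.eq_zero_of_abs_lt_dvd hmem habs
    omega
  -- sum over the Fricke cosets only
  have hsum : ∑ j ∈ Finset.range N, term (q j) ≤ rsCoeff N 2 f 1 := by
    rw [rsCoeff_eq_sum, ← Finset.sum_image hinj]
    exact Finset.sum_le_sum_of_subset_of_nonneg (Finset.subset_univ _) fun r _ _ ↦ sq_nonneg _
  refine le_trans (le_of_eq ?_) hsum
  simp_rw [hval]
  rw [Finset.sum_const, Finset.card_range, nsmul_eq_mul]
  field_simp

end Fricke

end Literature.NumberTheory.EllipticCurves.ModularForms
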